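import Literature.GroupTheory.CombinatorialGroupTheory.FreeGroupoidWords

/-!
# Free groupoids of quivers: the one-arrow dichotomy for reduced representatives (Stallings §2.3)

Stallings, *Topology of finite graphs*, Invent. Math. **71** (1983) 551–565, §2.2–2.3 (p. 553) and
Prop. 5.2 (p. 557) [cite: Stallings1983, §2.3 p.553; Prop. 5.2 p.557].  Complements to
`FreeGroupoidWords.lean` (reduced zigzag paths as unique representatives of the morphisms of
Mathlib's free groupoid `Quiver.FreeGroupoid V`):

* `homMk_reverse_eq_inv` — the formal inverse arrow represents the inverse, `[f̄] = [f]⁻¹`;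
* `rep_comp_dichotomy` — for any choice `rep` of reduced representatives and an arrow `g`, either
  `rep (p ≫ [g]) = rep p · g` or `rep p = rep (p ≫ [g]) · ḡ`: composing with one arrow lengthens or
  shortens the reduced representative by exactly one letter (the mechanism behind "the universal
  cover of a graph is a tree": reduced length is a height function on the Cayley-type graph).
-/

namespace Literature.GroupTheory.CombinatorialGroupTheory.FreeGroupoidWords

open CategoryTheory Quiver

universe v u

variable {V : Type u} [Quiver.{v} V]

/-- The formal inverse arrow represents the inverse: `[f̄] = [f]⁻¹` in the free groupoid.
[cite: Stallings1983, §2.2 p.553] -/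
theorem homMk_reverse_eq_inv {X Y : Symmetrify V} (f : X ⟶ Y) :
    homMk (Quiver.reverse f).toPath = inv (homMk f.toPath) := by
  apply IsIso.eq_inv_of_hom_inv_id
  rw [← homMk_comp]
  exact homMk_toPath_comp_reverse f

/-- **Crossing one arrow changes the reduced length by one.**  For a choice `rep` of reduced
representatives and an arrow `g : Y ⟶ Z` of the symmetrified quiver: either the reduced
representative of `p ≫ [g]` is that of `p` extended by `g`, or the reduced representative of `p` is
that of `p ≫ [g]` extended by `ḡ` (the last arrow of `rep p` cancels against `g`).
[cite: Stallings1983, §2.3 p.553] -/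
theorem rep_comp_dichotomy {X : Symmetrify V}
    (rep : ∀ {Y : Symmetrify V}, (obj X ⟶ obj Y) → Path X Y)
    (hrep : ∀ {Y : Symmetrify V} (f : obj X ⟶ obj Y), IsReduced (rep f) ∧ homMk (rep f) = f)
    {Y Z : Symmetrify V} (p : obj X ⟶ obj Y) (g : Y ⟶ Z) :
    rep (p ≫ homMk g.toPath) = (rep p).cons g ∨
      rep p = (rep (p ≫ homMk g.toPath)).cons (Quiver.reverse g) := by
  have huniq : ∀ {Y : Symmetrify V} (f : obj X ⟶ obj Y) (r : Path X Y),
      IsReduced r → homMk r = f → rep f = r :=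
    fun f r hr hrf => eq_of_isReduced (hrep f).1 hr ((hrep f).2.trans hrf.symm)
  obtain ⟨hr, hrp⟩ := hrep p
  -- split off the last arrow of `rep p`
  rcases hlast : rep p with _ | ⟨r', f⟩
  · -- `rep p` is empty: extending by `g` stays reduced
    rw [hlast] at hr hrp
    left
    apply huniq
    · exact IsReduced.toPath g
    · rw [homMk_cons, ← hrp]
  · rw [hlast] at hr hrp
    by_cases hc : (letter g).1 = (letter f).1 → (letter g).2 = (letter f).2
    · -- no cancellation: `rep p` extended by `g` is reduced
      left
      apply huniq
      · exact (isReduced_cons_cons_iff r' f g).mpr ⟨hc, hr⟩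
      · rw [homMk_cons, hrp]
    · -- cancellation: `f = ḡ`
      right
      rw [Classical.not_imp] at hc
      have hl : letter f = letter (Quiver.reverse g) := by
        rw [letter_reverse]
        exact Prod.ext hc.1.symm ((Bool.eq_not.mpr (Ne.symm hc.2)))
      have ht := total_eq_of_letter_eq f (Quiver.reverse g) hl
      cases ht
      have hr' : IsReduced r' := hr.of_cons
      have hcomp : homMk r' = p ≫ homMk g.toPath := by
        rw [← hrp, homMk_cons, Category.assoc, ← homMk_comp]
        have h1 := homMk_toPath_comp_reverse (Quiver.reverse g)
        rw [Quiver.reverse_reverse] at h1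
        rw [h1, Category.comp_id]
      rw [huniq _ r' hr' hcomp]

end Literature.GroupTheory.CombinatorialGroupTheory.FreeGroupoidWords
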